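import Summits.ResolutionOfSingularities.ResolutionOfSingularities.Theorems.StallVertexLetterClasses
import Summits.ResolutionOfSingularities.ResolutionOfSingularities.Theorems.StallVertexRegime
import HarnessLib

/-!
# StallVertexStraightClasses — decomp-res node «StallVertex» (lens-5 g20/g21 rev 6), add-on tree file 15 of the node

Content VERBATIM from the decomp-res lens-5 file `HOME/decomp-res-lens-5/g21/StallVertex.lean` rev 6 (pin 95ed6f6f,
3 344 l; rev 6 SUPERSEDES rev 5 5d7e6b95,
rev 4 74ef32c0 and rev 3 549891b7 as landing source — pure insertions, all earlier statements byte-identical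
(critic machine diffs); HOME = run/shared/lean/pub/decomp-res).
The rev-0/1/2 sections are ALREADY in the tree (`StallVertexForms` / `Kernels` / `Walk` / `Classes` / `Clean` /
`Rigid` / `Lines` / `RigidClasses` / `MaxContactCutStallVertex`,
writer g7); the add-on files carry ONLY the declarations NEW in rev 3 / 4 / 5 / 6.  Critic: CRITIC-LEDGER rows 142c
(rev 3: the old-letter law, CLEARED 2026-08-30T21:45:00Z),
142d (rev 4: the general carried-line law + line dichotomy, DECIDED +1, 22:09:45Z), 142e (rev 5: the turn law,
22:25:58Z), 142f (rev 6: THE EVENT-FREE LEAF IS EMPTY +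
THE MONOMIAL REGIME, DECIDED +1 for (S) as a whole, 22:52:49Z) — landing orders INBOX :362 / :396 / :429 (2) /
:471.  Landed by decomp-res writer g8 as `StallVertexCarry`
(§1d–§1e), `StallVertexOldLetter` (§1g + §3d–§3e), `StallVertexLineTurn` (§3f–§3g),
`StallVertexLetterClasses` (§4d–§4e classes and exact re-locations),
`StallVertexRegime` (§1i the monomial carry law + §3h a derivative is always carried / the monomial step),
`StallVertexStraightClasses` (§4f + §4g classes and exact
re-locations) and the wiring file `MaxContactCutStallVertexEvents` (every new `closes_…` /
`defectWalksDeep_iff_…` BY NAME on `MaxContactCut.DefectWalksDeep`).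
All `--supports stmt-ResolutionOfSingularities-31770`.  Every file of the node is in the Theses cone (the lens
imports the in-cone `DifferentialShade`), so the located
residual is booked on the route by RE-LOCATING the existing aside 28122 `CFNoSkewJointTailsDeep` to
`StallVertex.NoMonomialRegimeSkewStalledTailsDeep` (EXACT,
hypothesis-free chain skew ↔ vertexBound ↔ rigid ↔ lineFree ↔ letterFree ↔ eventFree ↔ straight ↔
monomialRegime: `skew_iff_monomialRegime`) — one aside on this
column, superseding the straight / event-free re-locations (critic row 142f: «file only the newest, exactly one
aside on this column; decided cells not filed»).

§4f (rev 5, `section Classes`) THE TURN CELL `NoTurningCleanSkewStalledTailsDeep` DECIDED by the turn law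
(`noTurningCleanSkewStalledTailsDeep_holds`;
`oldLetterAt_or_youngMonomialAt_of_monomial`) and the straight class `NoStraightEventFreeSkewStalledTailsDeep`
(`straight_of_eventFree` / `eventFree_of_straight` /
EXACT `eventFree_iff_straight` / `lineFree_iff_straight` / `skew_iff_straight`); §4g (rev 6) THE EVENT-FREE LEAF IS
EMPTY — `turns_of_stays`, `youngMonomialAt_succ`,
`monomialRegime_of_youngMonomialAt`, the young-free clean cell `NoYoungFreeCleanSkewStalledTailsDeep` DECIDED
(`noYoungFreeCleanSkewStalledTailsDeep_holds`) — and
**THE LOCATED RESIDUAL OF THE NODE `NoMonomialRegimeSkewStalledTailsDeep`** (interference ∨ the eternal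
young-monomial regime) with `monomialRegime_of_straight` /
`straight_of_monomialRegime` / EXACT `straight_iff_monomialRegime` / `lineFree_iff_monomialRegime` /
`skew_iff_monomialRegime : CoefficientCut.NoSkewJointTailsDeep ↔
NoMonomialRegimeSkewStalledTailsDeep` (hypothesis-free).  0 sorry.  Imports `StallVertexLetterClasses` and `StallVertexRegime`.

[WRITER NOTE (decomp-res writer g8): file split only; namespace, opens, section variables and every declaration
exactly as in the lens (global `set_option` dropped; the lens's `set_option maxHeartbeats … in` lines kept; the
lens's private copy `flat_monomial'` of the landed
`Literature.AlgebraicGeometry.Resolution.PointBlowup.flat_monomial` is dropped and cited by its full name).]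

(Sources: KawanoueMatsuki2016 Prop. 4 (2), §4.1; Kawanoue2007 Lemma 2.2.1.2; BierstoneGrigorievMilmanWlodarczyk2011
Def. 3.1.3; Hauser2010; HauserPerlega2024; Moh1987; CossartPiltant2008; Giraud1975; Hironaka1964; ZariskiSamuelII Ch. VIII §2.)
-/

noncomputable section

open MvPolynomial Finset
open Literature.AlgebraicGeometry.Resolution
open Literature.AlgebraicGeometry.Resolution.Hauser2010
open Literature.AlgebraicGeometry.Resolution.HauserPerlega2024
open Literature.Barriers.ResolutionOfSingularities
open Literature.AlgebraicGeometry.Resolution.PointBlowup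
open Summit.ResolutionOfSingularities.ResolutionOfSingularities.Theses
open Summit.ResolutionOfSingularities.ResolutionOfSingularities.Theorems.TightDefectClasses
open Summit.ResolutionOfSingularities.ResolutionOfSingularities.Theorems.ProximityCut
open Summit.ResolutionOfSingularities.ResolutionOfSingularities.Theorems.ExitLaw
open Summit.ResolutionOfSingularities.ResolutionOfSingularities.Theorems.DifferentialShade

namespace Summit.ResolutionOfSingularities.ResolutionOfSingularities.Theorems.StallVertex

section Classes

/-! ### §4f THE TURN CELL (decided by the turn law) and the exact re-location of the event-free residual -/

/-- A MONOMIAL cone of a minimiser is an old-letter event or a young monomial (by whether some letter of it is old).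
[folklore] -/
theorem oldLetterAt_or_youngMonomialAt_of_monomial {K : Type} [Field K] [DecidableEq K] {q : ℕ}
    {s₀ : State (Fin 3) K} (W : ForcedWalk q s₀) (t : ℕ) {J₀ : Fin 3 →₀ ℕ} (hJ₀ : J₀ ∈ (ifp W t).idx)
    (hμ : (ifp W t).muP q = levelRatio (ordZero ((ifp W t).gen J₀)) (q - J₀.degree))
    {S : Fin 3 →₀ ℕ} {ρ : K} (hρ : ρ ≠ 0) (hd : ordZero ((ifp W t).gen J₀) = ((S.degree : ℕ) : ℕ∞))
    (hG : homogeneousComponent S.degree ((ifp W t).gen J₀) = monomial S ρ) :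
    OldLetterAt W t ∨ YoungMonomialAt W t := by
  classical
  by_cases hold : ∃ m', S m' ≠ 0 ∧ m' ∉ (ifp W t).young
  · obtain ⟨m', hm'S, hm'y⟩ := hold
    have hSe : (S.erase m').degree + S m' = S.degree := by
      conv_rhs => rw [← Finsupp.erase_add_single m' S]
      rw [map_add, Finsupp.degree_single]
    refine Or.inl ⟨J₀, hJ₀, hμ, m', hm'y, S.erase m', ρ, 1, S m', hρ, one_ne_zero, Nat.pos_of_ne_zero hm'S,
      by rw [hSe]; exact hd, ?_⟩
    rw [hSe, hG, monomial_mul_C_mul_X_pow, one_pow, mul_one, Finsupp.erase_add_single]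
  · push Not at hold
    exact Or.inr ⟨J₀, hJ₀, hμ, S, ρ, hρ, hd, hG, hold⟩

/-- DECIDED CLASS (f″): **TURNING CLEAN SKEW STALLED TAILS** — the line-free rigid skew stalled residual's binders
VERBATIM, plus: eventually clean from some `N₁ ≥ N`, NO young monomial at any time `≥ N₁`, a derivative still carried
at `N₁` (`μ_P < ∞`: the unit is not resolved), and the chart letter CHANGES infinitely often (`W.j (t+1) ≠ W.j t` for
unboundedly many `t`: the walk TURNS).  PROVED EMPTY below by the turn law: at a turn `t ≥ N₁` the minimiser's cone at
`t + 2` is a monomial — an old-letter event (the empty old-letter cell) or a young monomial (the binder). -/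
def NoTurningCleanSkewStalledTailsDeep : Prop :=
  ∀ p : ℕ, p.Prime → ∀ e : ℕ, 2 ≤ e → ∀ (K : Type) [Field K] [CharP K p] [PerfectField K] [DecidableEq K]
    (s₀ : State (Fin 3) K), IsRoot (p ^ e) s₀ → ∀ W : ForcedWalk (p ^ e) s₀, (∀ i, 1 ≤ (W.st i).shade) →
    ∀ N : ℕ, (∀ t, N ≤ t → (W.st (t + 1)).shade = (W.st t).shade) →
    (∀ t, N ≤ t → ordZero (W.st t).F ≠ ((p ^ e : ℕ) : ℕ∞)) →
    (∀ M : ℕ, ∃ t, M ≤ t ∧ StaysOnNewest W t) → (∀ M : ℕ, ∃ t, M ≤ t ∧ W.b t ≠ 0) →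
    (∀ (k : Fin 3) (N' : ℕ), ∃ t, N' ≤ t ∧ (W.j t = k ∨ W.b t k ≠ 0)) →
    (∀ t, N ≤ t → (ifp W (t + 1)).muTilde (p ^ e) = (ifp W t).muTilde (p ^ e)) →
    (∀ t, N ≤ t → VertexLawEqAt W t) → (∀ t, N ≤ t → OriginLawAt W t) →
    (∀ (s : ℕ) (c : Fin 3 → K), ¬ ContactLineFrom W s c) →
    ∀ N₁ : ℕ, N ≤ N₁ → (∀ t, N₁ ≤ t → CleanAt W t) → (∀ t, N₁ ≤ t → ¬ YoungMonomialAt W t) →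
    (ifp W N₁).muP (p ^ e) ≠ ⊤ → (∀ M : ℕ, ∃ t, M ≤ t ∧ W.j (t + 1) ≠ W.j t) → False

/-- **The turn cell is EMPTY** (kernel, every `q = p^e`, every field of characteristic `p`). [folklore] -/
theorem noTurningCleanSkewStalledTailsDeep_holds : NoTurningCleanSkewStalledTailsDeep := by
  intro p hp e he K _ _ _ _ s₀ hs W hsh N hplat hexc hS hT hskew hstall hrig horig hlf N₁ hN₁ hcl hnoY hfin hturn
  obtain ⟨t, ht, hjt⟩ := hturn N₁
  obtain ⟨J₀, hJ₀, hμ, hgne⟩ := exists_minimiser W t (muP_ne_top_of_le hp hs W hfin ht)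
  obtain ⟨hJ₂, hμ₂, S, ρ, hρ, hd₂, hG₂⟩ := turn_monomial hp hs W t (hstall t (by omega)) (hstall (t + 1) (by omega))
    (hcl t ht) (hcl (t + 1) (by omega)) hjt hJ₀ hμ hgne
  rcases oldLetterAt_or_youngMonomialAt_of_monomial W (t + 2) hJ₂ hμ₂ hρ hd₂ hG₂ with hold | hyoung
  · exact noOldLetterCleanSkewStalledTailsDeep_holds p hp e he K s₀ hs W hsh N hplat hexc hS hT hskew hstall hrig horig
      hlf N₁ hN₁ hcl (t + 2) (by omega) hold
  · exact hnoY (t + 2) (by omega) hyoung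

/-- LOCATED RESIDUAL after the turn cut: line-free rigid skew stalled tails that are EITHER unclean infinitely often
(INTERFERENCE) OR eventually clean and then EITHER reach a YOUNG MONOMIAL cone (the monomial regime) OR never show a
line event AND are STRAIGHT: the unit is already resolved at `N₁` (`μ_P = ∞`, no derivative carried) or THE CHART
LETTER IS CONSTANT from `N₁` on (`W.j (t+1) = W.j t`: translations only, in one chart, forever). -/
def NoStraightEventFreeSkewStalledTailsDeep : Prop :=
  ∀ p : ℕ, p.Prime → ∀ e : ℕ, 2 ≤ e → ∀ (K : Type) [Field K] [CharP K p] [PerfectField K] [DecidableEq K]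
    (s₀ : State (Fin 3) K), IsRoot (p ^ e) s₀ → ∀ W : ForcedWalk (p ^ e) s₀, (∀ i, 1 ≤ (W.st i).shade) →
    ∀ N : ℕ, (∀ t, N ≤ t → (W.st (t + 1)).shade = (W.st t).shade) →
    (∀ t, N ≤ t → ordZero (W.st t).F ≠ ((p ^ e : ℕ) : ℕ∞)) →
    (∀ M : ℕ, ∃ t, M ≤ t ∧ StaysOnNewest W t) → (∀ M : ℕ, ∃ t, M ≤ t ∧ W.b t ≠ 0) →
    (∀ (k : Fin 3) (N' : ℕ), ∃ t, N' ≤ t ∧ (W.j t = k ∨ W.b t k ≠ 0)) →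
    (∀ t, N ≤ t → (ifp W (t + 1)).muTilde (p ^ e) = (ifp W t).muTilde (p ^ e)) →
    (∀ t, N ≤ t → VertexLawEqAt W t) → (∀ t, N ≤ t → OriginLawAt W t) →
    (∀ (s : ℕ) (c : Fin 3 → K), ¬ ContactLineFrom W s c) →
    ((∀ N₁ : ℕ, N ≤ N₁ → ∃ t, N₁ ≤ t ∧ ¬ CleanAt W t) ∨
      (∃ N₁ : ℕ, N ≤ N₁ ∧ (∀ t, N₁ ≤ t → CleanAt W t) ∧
        ((∃ t, N₁ ≤ t ∧ YoungMonomialAt W t) ∨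
          ((∀ t₀, N₁ ≤ t₀ → ¬ LineEventAt W t₀) ∧
            ((ifp W N₁).muP (p ^ e) = ⊤ ∨ ∀ t, N₁ ≤ t → W.j (t + 1) = W.j t))))) → False

/-- Sub-class direction: the straight residual is implied by the event-free residual (binder dropped). [folklore] -/
theorem straight_of_eventFree (h : NoEventFreeLineFreeSkewStalledTailsDeep) :
    NoStraightEventFreeSkewStalledTailsDeep := by
  intro p hp e he K _ _ _ _ s₀ hs W hsh N hplat hexc hS hT hskew hstall hrig horig hlf hdisj
  refine h p hp e he K s₀ hs W hsh N hplat hexc hS hT hskew hstall hrig horig hlf ?_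
  rcases hdisj with hI | ⟨N₁, hN₁, hcl, hy | ⟨hnl, _⟩⟩
  · exact Or.inl hI
  · exact Or.inr ⟨N₁, hN₁, hcl, Or.inl hy⟩
  · exact Or.inr ⟨N₁, hN₁, hcl, Or.inr hnl⟩

/-- **EXACT RE-LOCATION**: event-free ⟸ straight, by the turn law (through the turn cell). [folklore] -/
theorem eventFree_of_straight (h : NoStraightEventFreeSkewStalledTailsDeep) :
    NoEventFreeLineFreeSkewStalledTailsDeep := by
  intro p hp e he K _ _ _ _ s₀ hs W hsh N hplat hexc hS hT hskew hstall hrig horig hlf hdisj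
  rcases hdisj with hI | ⟨N₁, hN₁, hcl, hy | hnl⟩
  · exact h p hp e he K s₀ hs W hsh N hplat hexc hS hT hskew hstall hrig horig hlf (Or.inl hI)
  · exact h p hp e he K s₀ hs W hsh N hplat hexc hS hT hskew hstall hrig horig hlf (Or.inr ⟨N₁, hN₁, hcl, Or.inl hy⟩)
  · by_cases hfin : (ifp W N₁).muP (p ^ e) = ⊤
    · exact h p hp e he K s₀ hs W hsh N hplat hexc hS hT hskew hstall hrig horig hlf
        (Or.inr ⟨N₁, hN₁, hcl, Or.inr ⟨hnl, Or.inl hfin⟩⟩)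
    · by_cases hy : ∃ t, N₁ ≤ t ∧ YoungMonomialAt W t
      · exact h p hp e he K s₀ hs W hsh N hplat hexc hS hT hskew hstall hrig horig hlf
          (Or.inr ⟨N₁, hN₁, hcl, Or.inl hy⟩)
      · push Not at hy
        by_cases hturn : ∀ M : ℕ, ∃ t, M ≤ t ∧ W.j (t + 1) ≠ W.j t
        · exact noTurningCleanSkewStalledTailsDeep_holds p hp e he K s₀ hs W hsh N hplat hexc hS hT hskew hstall hrig
            horig hlf N₁ hN₁ hcl hy hfin hturn
        · push Not at hturn
          obtain ⟨M, hM⟩ := hturn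
          exact h p hp e he K s₀ hs W hsh N hplat hexc hS hT hskew hstall hrig horig hlf
            (Or.inr ⟨max N₁ M, le_trans hN₁ (le_max_left _ _), fun t ht => hcl t (le_trans (le_max_left _ _) ht),
              Or.inr ⟨fun t₀ ht₀ => hnl t₀ (le_trans (le_max_left _ _) ht₀),
                Or.inr fun t ht => hM t (le_trans (le_max_right _ _) ht)⟩⟩)

/-- `eventFree_iff_straight`: Auxiliary step of this node's calculus, VERBATIM from the lens file (see the module
docstring); the statement is its type. [folklore] -/
theorem eventFree_iff_straight : NoEventFreeLineFreeSkewStalledTailsDeep ↔ NoStraightEventFreeSkewStalledTailsDeep :=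
  ⟨straight_of_eventFree, eventFree_of_straight⟩

/-- The rev-2 line-free residual, too, IS the straight residual (all located residuals are exactly equivalent). [folklore] -/
theorem lineFree_iff_straight : NoLineFreeRigidSkewStalledTailsDeep ↔ NoStraightEventFreeSkewStalledTailsDeep :=
  lineFree_iff_eventFree.trans eventFree_iff_straight

/-- The g19 skew residual ⟺ the straight residual (hypothesis-free). [folklore] -/
theorem skew_iff_straight : CoefficientCut.NoSkewJointTailsDeep ↔ NoStraightEventFreeSkewStalledTailsDeep :=
  skew_iff_eventFree.trans eventFree_iff_straight

/-! ### §4g THE EVENT-FREE LEAF IS EMPTY (a derivative is always carried; proximity repeats turn the walk; the monomial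
regime propagates) and the exact re-location of the straight residual to THE MONOMIAL REGIME (rev 6) -/

/-- The proximity-repeat binder TURNS the walk infinitely often (`StaysOnNewest W t` changes the chart at `t + 1`): the
«one chart forever» alternative of the straight residual is VACUOUS. [folklore] -/
theorem turns_of_stays {K : Type} [Field K] [DecidableEq K] {q : ℕ} {s₀ : State (Fin 3) K} (W : ForcedWalk q s₀)
    (hS : ∀ M : ℕ, ∃ t, M ≤ t ∧ StaysOnNewest W t) : ∀ M : ℕ, ∃ t, M ≤ t ∧ W.j (t + 1) ≠ W.j t := by
  intro M
  obtain ⟨t, ht, hst⟩ := hS M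
  exact ⟨t, ht, hst.1⟩

/-- **THE MONOMIAL REGIME PROPAGATES (one step)**: a young monomial cone at a clean stalled move is a young monomial cone
of the same minimiser at the next time — the new chart letter is young, and a kept letter was young and untranslated,
so it stays young (`monomial_step`). [new] [folklore] -/
theorem youngMonomialAt_succ {K : Type} [Field K] [DecidableEq K] {p e : ℕ} (hp : p.Prime) [CharP K p]
    {s₀ : State (Fin 3) K} (hs : IsRoot (p ^ e) s₀) (W : ForcedWalk (p ^ e) s₀) (t : ℕ)
    (hst : (ifp W (t + 1)).muTilde (p ^ e) = (ifp W t).muTilde (p ^ e)) (hcl : CleanAt W t)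
    (hy : YoungMonomialAt W t) : YoungMonomialAt W (t + 1) := by
  classical
  obtain ⟨J₀, hJ₀, hμ, S, ρ, hρ, hd₀, hG, hyoung⟩ := hy
  obtain ⟨hJ₁, hμ₁, -, hd₁, hG₁⟩ := monomial_step hp hs W t hst hcl hJ₀ hμ S hρ hd₀ hG
  have hdeg : (Finsupp.single (W.j t) (S.degree - (p ^ e - J₀.degree)) +
      (S.erase (W.j t)).filter (fun i => W.b t i = 0)).degree =
      S.degree - (p ^ e - J₀.degree) + ((S.erase (W.j t)).filter (fun i => W.b t i = 0)).degree := by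
    rw [map_add, Finsupp.degree_single]
  refine ⟨J₀, hJ₁, hμ₁,
    Finsupp.single (W.j t) (S.degree - (p ^ e - J₀.degree)) + (S.erase (W.j t)).filter (fun i => W.b t i = 0),
    ρ * ∏ i ∈ univ.filter (fun i => W.b t i ≠ 0), W.b t i ^ ((S.erase (W.j t)) i),
    mul_ne_zero hρ (Finset.prod_ne_zero_iff.mpr fun i hi => pow_ne_zero _ (Finset.mem_filter.mp hi).2),
    by rw [hdeg]; exact hd₁, by rw [hdeg]; exact hG₁, ?_⟩
  intro i hi
  rw [ifp_succ]
  show i ∈ insert (W.j t) ((ifp W t).young.filter fun i => W.b t i = 0)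
  rw [Finset.mem_insert, Finset.mem_filter]
  by_cases hij : i = W.j t
  · exact Or.inl hij
  · right
    rw [Finsupp.add_apply, Finsupp.single_eq_of_ne hij, zero_add, Finsupp.filter_apply] at hi
    by_cases hbi : W.b t i = 0
    · rw [if_pos hbi, Finsupp.erase_ne hij] at hi
      exact ⟨hyoung i hi, hbi⟩
    · rw [if_neg hbi] at hi
      exact absurd rfl hi

/-- **THE MONOMIAL REGIME (induction on the monomial step).**  On a stalled stretch of a root walk that is clean for the
minimisers from `t₀` on, a young monomial cone at `t₀` makes the cone of that minimiser a YOUNG MONOMIAL AT EVERY LATER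
TIME: the monomial regime, once entered cleanly, is never left. [new] [folklore] -/
theorem monomialRegime_of_youngMonomialAt {K : Type} [Field K] [DecidableEq K] {p e : ℕ} (hp : p.Prime) [CharP K p]
    {s₀ : State (Fin 3) K} (hs : IsRoot (p ^ e) s₀) (W : ForcedWalk (p ^ e) s₀) (t₀ : ℕ)
    (hst : ∀ t, t₀ ≤ t → (ifp W (t + 1)).muTilde (p ^ e) = (ifp W t).muTilde (p ^ e))
    (hcl : ∀ t, t₀ ≤ t → CleanAt W t) (hy : YoungMonomialAt W t₀) : ∀ t, t₀ ≤ t → YoungMonomialAt W t := by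
  have key : ∀ n : ℕ, YoungMonomialAt W (t₀ + n) := by
    intro n
    induction n with
    | zero => exact hy
    | succ n ih =>
      exact youngMonomialAt_succ hp hs W (t₀ + n) (hst _ (Nat.le_add_right _ _)) (hcl _ (Nat.le_add_right _ _)) ih
  intro t ht
  obtain ⟨n, rfl⟩ := Nat.exists_eq_add_of_le ht
  exact key n

/-- DECIDED CLASS (g″): **YOUNG-FREE CLEAN SKEW STALLED TAILS** — the line-free rigid skew stalled residual's binders
VERBATIM, plus: every move is clean for the minimisers from some `N₁ ≥ N` on and NO minimiser's cone at any time `≥ N₁`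
is a young monomial.  NO `μ_P < ∞` binder, NO turning binder (both are theorems of every root walk: `muP_ne_top`,
`turns_of_stays`) and NO line-event binder.  PROVED EMPTY below: THE WHOLE YOUNG-FREE CLEAN LEAF — in particular the
event-free leaf of rev 5, all three of its alternatives — IS DECIDED (kernel, every `q = p^e`, every perfect field). -/
def NoYoungFreeCleanSkewStalledTailsDeep : Prop :=
  ∀ p : ℕ, p.Prime → ∀ e : ℕ, 2 ≤ e → ∀ (K : Type) [Field K] [CharP K p] [PerfectField K] [DecidableEq K]
    (s₀ : State (Fin 3) K), IsRoot (p ^ e) s₀ → ∀ W : ForcedWalk (p ^ e) s₀, (∀ i, 1 ≤ (W.st i).shade) →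
    ∀ N : ℕ, (∀ t, N ≤ t → (W.st (t + 1)).shade = (W.st t).shade) →
    (∀ t, N ≤ t → ordZero (W.st t).F ≠ ((p ^ e : ℕ) : ℕ∞)) →
    (∀ M : ℕ, ∃ t, M ≤ t ∧ StaysOnNewest W t) → (∀ M : ℕ, ∃ t, M ≤ t ∧ W.b t ≠ 0) →
    (∀ (k : Fin 3) (N' : ℕ), ∃ t, N' ≤ t ∧ (W.j t = k ∨ W.b t k ≠ 0)) →
    (∀ t, N ≤ t → (ifp W (t + 1)).muTilde (p ^ e) = (ifp W t).muTilde (p ^ e)) →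
    (∀ t, N ≤ t → VertexLawEqAt W t) → (∀ t, N ≤ t → OriginLawAt W t) →
    (∀ (s : ℕ) (c : Fin 3 → K), ¬ ContactLineFrom W s c) →
    ∀ N₁ : ℕ, N ≤ N₁ → (∀ t, N₁ ≤ t → CleanAt W t) → (∀ t, N₁ ≤ t → ¬ YoungMonomialAt W t) → False

/-- **The young-free clean cell is EMPTY**: the turn cell (f″), its two extra binders now supplied by `muP_ne_top` (a
derivative is always carried) and `turns_of_stays` (proximity repeats turn the walk). [folklore] -/
theorem noYoungFreeCleanSkewStalledTailsDeep_holds : NoYoungFreeCleanSkewStalledTailsDeep := by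
  intro p hp e he K _ _ _ _ s₀ hs W hsh N hplat hexc hS hT hskew hstall hrig horig hlf N₁ hN₁ hcl hnoY
  exact noTurningCleanSkewStalledTailsDeep_holds p hp e he K s₀ hs W hsh N hplat hexc hS hT hskew hstall hrig horig hlf
    N₁ hN₁ hcl hnoY (muP_ne_top hp hs W N₁) (turns_of_stays W hS)

/-- LOCATED RESIDUAL after the event-free cut (rev 6): line-free rigid skew stalled tails that are EITHER unclean
infinitely often (INTERFERENCE) OR, from some time `N₁ ≥ N` on, clean AND IN THE MONOMIAL REGIME — at every
time `≥ N₁`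
some `μ_P`-minimiser's tangent cone is a YOUNG MONOMIAL `ρ·u^S` (Kawanoue–Matsuki's monomial case read off the cones,
forever; its one-step dynamics is `monomial_step`).  Every other alternative of the rev-5 straight residual is DEAD: the
unit is never resolved (`muP_ne_top`), the chart letter never freezes (`turns_of_stays`), the young-free clean leaf is
the empty cell (g″). -/
def NoMonomialRegimeSkewStalledTailsDeep : Prop :=
  ∀ p : ℕ, p.Prime → ∀ e : ℕ, 2 ≤ e → ∀ (K : Type) [Field K] [CharP K p] [PerfectField K] [DecidableEq K]
    (s₀ : State (Fin 3) K), IsRoot (p ^ e) s₀ → ∀ W : ForcedWalk (p ^ e) s₀, (∀ i, 1 ≤ (W.st i).shade) →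
    ∀ N : ℕ, (∀ t, N ≤ t → (W.st (t + 1)).shade = (W.st t).shade) →
    (∀ t, N ≤ t → ordZero (W.st t).F ≠ ((p ^ e : ℕ) : ℕ∞)) →
    (∀ M : ℕ, ∃ t, M ≤ t ∧ StaysOnNewest W t) → (∀ M : ℕ, ∃ t, M ≤ t ∧ W.b t ≠ 0) →
    (∀ (k : Fin 3) (N' : ℕ), ∃ t, N' ≤ t ∧ (W.j t = k ∨ W.b t k ≠ 0)) →
    (∀ t, N ≤ t → (ifp W (t + 1)).muTilde (p ^ e) = (ifp W t).muTilde (p ^ e)) →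
    (∀ t, N ≤ t → VertexLawEqAt W t) → (∀ t, N ≤ t → OriginLawAt W t) →
    (∀ (s : ℕ) (c : Fin 3 → K), ¬ ContactLineFrom W s c) →
    ((∀ N₁ : ℕ, N ≤ N₁ → ∃ t, N₁ ≤ t ∧ ¬ CleanAt W t) ∨
      (∃ N₁ : ℕ, N ≤ N₁ ∧ (∀ t, N₁ ≤ t → CleanAt W t) ∧ ∀ t, N₁ ≤ t → YoungMonomialAt W t)) → False

/-- Sub-class direction: the monomial-regime residual is implied by the straight residual (a regime from `N₁` on shows
the young monomial at `N₁`). [folklore] -/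
theorem monomialRegime_of_straight (h : NoStraightEventFreeSkewStalledTailsDeep) :
    NoMonomialRegimeSkewStalledTailsDeep := by
  intro p hp e he K _ _ _ _ s₀ hs W hsh N hplat hexc hS hT hskew hstall hrig horig hlf hdisj
  refine h p hp e he K s₀ hs W hsh N hplat hexc hS hT hskew hstall hrig horig hlf ?_
  rcases hdisj with hI | ⟨N₁, hN₁, hcl, hreg⟩
  · exact Or.inl hI
  · exact Or.inr ⟨N₁, hN₁, hcl, Or.inl ⟨N₁, le_rfl, hreg N₁ le_rfl⟩⟩

/-- **EXACT RE-LOCATION**: straight ⟸ monomial regime.  The young-monomial alternative enters the regime for good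
(`monomialRegime_of_youngMonomialAt`, shifting `N₁` to the event); the «unit resolved» alternative contradicts
`muP_ne_top`; the «one chart forever» alternative contradicts `turns_of_stays`. [folklore] -/
theorem straight_of_monomialRegime (h : NoMonomialRegimeSkewStalledTailsDeep) :
    NoStraightEventFreeSkewStalledTailsDeep := by
  intro p hp e he K _ _ _ _ s₀ hs W hsh N hplat hexc hS hT hskew hstall hrig horig hlf hdisj
  rcases hdisj with hI | ⟨N₁, hN₁, hcl, ⟨t₀, ht₀, hy⟩ | ⟨_, hfin | hconst⟩⟩
  · exact h p hp e he K s₀ hs W hsh N hplat hexc hS hT hskew hstall hrig horig hlf (Or.inl hI)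
  · exact h p hp e he K s₀ hs W hsh N hplat hexc hS hT hskew hstall hrig horig hlf
      (Or.inr ⟨t₀, le_trans hN₁ ht₀, fun t ht => hcl t (le_trans ht₀ ht),
        monomialRegime_of_youngMonomialAt hp hs W t₀ (fun t ht => hstall t (by omega))
          (fun t ht => hcl t (le_trans ht₀ ht)) hy⟩)
  · exact muP_ne_top hp hs W N₁ hfin
  · obtain ⟨t, ht, hne⟩ := turns_of_stays W hS N₁
    exact hne (hconst t ht)

/-- `straight_iff_monomialRegime`: Auxiliary step of this node's calculus, VERBATIM from the lens file (see the
module docstring); the statement is its type. [folklore] -/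
theorem straight_iff_monomialRegime :
    NoStraightEventFreeSkewStalledTailsDeep ↔ NoMonomialRegimeSkewStalledTailsDeep :=
  ⟨monomialRegime_of_straight, straight_of_monomialRegime⟩

/-- The rev-2 line-free residual, too, IS the monomial-regime residual. [folklore] -/
theorem lineFree_iff_monomialRegime : NoLineFreeRigidSkewStalledTailsDeep ↔ NoMonomialRegimeSkewStalledTailsDeep :=
  lineFree_iff_straight.trans straight_iff_monomialRegime

/-- The g19 skew residual ⟺ the monomial-regime residual (hypothesis-free). [folklore] -/
theorem skew_iff_monomialRegime : CoefficientCut.NoSkewJointTailsDeep ↔ NoMonomialRegimeSkewStalledTailsDeep :=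
  skew_iff_straight.trans straight_iff_monomialRegime

end Classes

end Summit.ResolutionOfSingularities.ResolutionOfSingularities.Theorems.StallVertex
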